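import Summits.SmoothPoincare4.Statement
import Literature.StrongHypotheses.SmoothPoincare4
import HarnessLib
import HarnessLib.Audit.TribunalTags

/-!
# Summit `SmoothPoincare4` — bridges of the Strong-Hypothesis Library (D-0034, skeleton)

Summit-side BRIDGE file for the registry `Literature/StrongHypotheses/SmoothPoincare4.lean` (census
there): for each `H` tagged `@[strong_hypothesis "SmoothPoincare4.SmoothPoincare4"]`, exactly ONE bridge
tagged `@[summit_bridge "SmoothPoincare4.SmoothPoincare4"]`, concluding the ROOT problem decl
`_root_.SmoothPoincare4` (`Summits/SmoothPoincare4/SmoothPoincare4/Statement.lean`,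
`:= Literature.SPC4.SmoothPoincareConjectureFour.{0}`).

* PRINTED (2, named facts per CONVENTIONS §4, to be discharged by a literature-prover as
  `theorem <name>_holds` in `Summits/SmoothPoincare4/SmoothPoincare4/Theorems/StrongHypotheses<H>Bridge.lean`):
  `HCobordantSphereFourStandardImpliesSmoothPoincare4` (over `Θ₄ = 0`, Kervaire–Milnor 1963, tree fact
  `Literature.Topology.FourManifolds.isHCobordant_sphere_of_homotopySphere_four`) and
  `NoOneHandlesAndStrictGPRImpliesSmoothPoincare4` (Gompf–Scharlemann–Thompson 2010 §9 / Prop. 9.2).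
* LANDED: none. No summit-side conjecture `def` is tagged: every closed `Prop` of this summit that is
  landed-equivalent to `P` is a ROUTE decl (Theses) or a slice of one (census, Literature file).

No new mathematics is proved here; no `sorry`, no axiom.
-/

noncomputable section

namespace Summit.SmoothPoincare4.StrongHypotheses

open Literature.StrongHypotheses.SmoothPoincare4

/-- **h-cobordism conjecture at `S⁴` ⟹ SPC4** — named fact: if every closed smooth 4-manifold smoothly
h-cobordant to `S⁴` is diffeomorphic to `S⁴` (`HCobordantSphereFourStandard`), then every smooth
homotopy 4-sphere is diffeomorphic to `S⁴`. In print: a homotopy 4-sphere `Σ` is compact and simply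
connected with zero intersection form, hence h-cobordant to `S⁴` — `Θ₄ = 0` (Kervaire–Milnor 1963,
table p. 504 via Thm. 5.1, §4, Lemma 2.3; equivalently Wall 1964 Thm. 2 applied to `Σ ≃ S⁴`). PROOF
PLAN for the discharge `theorem HCobordantSphereFourStandardImpliesSmoothPoincare4_holds`
(`Summits/SmoothPoincare4/SmoothPoincare4/Theorems/StrongHypothesesHCobordantSphereFourStandardBridge.lean`):
unfold `_root_.SmoothPoincare4` / `Literature.SPC4.SmoothPoincareConjectureFour` and
`ContinuousMap.HomotopyEquiv.NonemptyDiffeomorphSphere`; given `M`, an atlas and `e : M ≃ₕ S⁴`, get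
`CompactSpace M` (`Literature.Topology.FourManifolds.compactSpace_of_homotopyEquiv_sphere_four…`,
`HomotopyS4CompactProofs`) and a smooth orientation of `M` (`exists_smoothOrientation_isCompatible`-type
lemma of `HCobordismWallConnectedSumProofs`, or transport from `S⁴`), bundle
`S : Literature.Topology.FourManifolds.HomotopySphere 4 := ⟨M, _, ⟨e⟩⟩`, apply the tree fact
`isHCobordant_sphere_of_homotopySphere_four S : IsHCobordant 4 M S⁴` (a named fact — the discharge is
conditional on it until `ThetaFourWall` / `PiStableFourCollapse` close its leaves), and finish with the
hypothesis. [cite: KervaireMilnorAnnals1963, table p. 504 (Θ₄ = 0) via Thm. 5.1, §4 and Lemma 2.3] -/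
@[summit_bridge "SmoothPoincare4.SmoothPoincare4"]
def HCobordantSphereFourStandardImpliesSmoothPoincare4 : Prop :=
  HCobordantSphereFourStandard → _root_.SmoothPoincare4

/-- **"no 1-handles + generalised Property R" ⟹ SPC4** — named fact: if every smooth homotopy
4-sphere is an R-link sphere `Σ_L` and the printed generalised Property R conjecture holds
(`NoOneHandlesAndStrictGPR`), then every smooth homotopy 4-sphere is diffeomorphic to `S⁴`. Printed:
Gompf–Scharlemann–Thompson, Geom. Topol. 14 (2010), §9 with Prop. 9.2 ("a smooth homotopy 4-sphere
`Σ` can be constructed by attaching to the trace of the surgery `n` 3-handles and a 4-handle";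
generalised Property R "implies the smooth Poincaré conjecture for homotopy spheres that admit
handle decompositions without 1-handles"): handle slides on `L` do not change `Σ_L`, and `Σ_unlink`
(`0`-framed `n`-component unlink, `n` 3-handles, one 4-handle) is `S⁴` by cancellation. PROOF PLAN for
the discharge `theorem NoOneHandlesAndStrictGPRImpliesSmoothPoincare4_holds`
(`Summits/SmoothPoincare4/SmoothPoincare4/Theorems/StrongHypothesesNoOneHandlesAndStrictGPRBridge.lean`):
given `M`, an atlas and `e : M ≃ₕ S⁴`, conjunct (i) gives `n`, `L`, `IsRLinkSphere M L`; from the trace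
`P` read off that surgery on `L` is `∂P ≅ ∂(♮ⁿ S¹ × B³) = #ⁿ S¹ × S²` (`RLinkSphere` roadmap:
`∂(trace) = S³_L`, `HandleDecomposition` of `V`), so conjunct (ii) — instantiated at the smoothness-fact
instances, which the prover must either construct or carry as hypotheses of a CONDITIONAL discharge —
yields a strict handle-slide sequence to the `0`-framed unlink `U`; strict slides induce diffeomorphisms
of traces rel boundary (`KirbyMovesStrictHandleSlide`), hence `M ≅ Σ_U`; and `Σ_U ≅ S⁴` by `n`
cancelling 2/3-handle pairs (Laudenbach–Poénaru uniqueness of the `♮ⁿ S¹ × B³` filling,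
`exists_diffeomorph_comp_incl_eq`). The summit-side helper
`Summit.SmoothPoincare4.SmoothPoincare4.Theorems.helper_stdSphereSlides_of_strictGPRC`
(`Theorems/VerlindeRLinksVrlSliceRigidityHelperStdSphereSlidesOfStrictGPRC`) already packages the
instantiation of (ii) at an R-link sphere. [cite: GompfScharlemannThompson2010, §9 and Prop. 9.2] -/
@[summit_bridge "SmoothPoincare4.SmoothPoincare4"]
def NoOneHandlesAndStrictGPRImpliesSmoothPoincare4 : Prop :=
  NoOneHandlesAndStrictGPR → _root_.SmoothPoincare4

end Summit.SmoothPoincare4.StrongHypotheses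

end
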